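import Mathlib
import Summits.Schanuel.Schanuel.Theorems.RigidCoreMinimalCounterexampleInAclWindowRigidityCosetLemmas

/-!
# COSET WINDOW RIGIDITY — crux stmt-Schanuel-0969 `RigidCore.MinimalCounterexampleInAcl`

Line `kernel-arithmetic-selection`, stub `stub_windowRigidity_coset` (gen 14 coset window
rigidity), `--supports stmt-Schanuel-0969`.  File 2 of 2 (file 1 `…WindowRigidityCosetLemmas.lean`
holds the divided-difference mean value theorem, the meromorphic derivative chain along the
principal root curve and the degenerate case).

Let `e ≥ 1`, `M` meromorphic at `0` (`t ↦ t ^ p * M t` analytic at `0`) and NOT of the form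
`Q((t ^ e)⁻¹)` near `0` for a polynomial `Q`.  For a coset `c + 2πiℤ` put
`t_k := (c + 2πik) ^ (-1/e)` (principal complex power).  Then for every finite pattern
`G ⊆ ℤ` with `|G| ≥ p + 2` only finitely many `k ∈ ℤ` have ALL the translates `k + j`,
`j ∈ G`, hitting the lattice: `M (t_{k+j}) ∈ 2πiℤ`.

PROOF (divided differences).  Along the real curve `s(τ) = (c + βτ)^{-1/e}` (`β = ±2πi`, one
sign per tail `k → ±∞`) one has `s' = α s^{e+1}`, `α = -β/e`, so `τ ↦ M (s τ)` has the
derivative chain `τ ↦ M_k (s τ)` with `M_k = F_k · t^{ke-p}`, `F_k` analytic at `0`.  The mean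
value theorem for divided differences over a recurring window expresses `Re M_n (s ξ₁)` and
`Im M_n (s ξ₂)` (`n = |G| - 1 > p`) through the hit values: real parts of hits vanish, imaginary
parts are `2π ×` integers combined with FIXED rational weights, and `M_n (s τ) → 0`; so both
vanish for large `k` (lattice step).  As `M` is non-degenerate, `F_n ≢ 0` near `0` (file 1,
Part D), so `F_n = t^m v`, `v(0) ≠ 0`, and `M_n (s τ) = ‖c + βτ‖^{-N/e} · E(τ)` with
`E(τ) → e^{-iN arg β / e} v(0) ≠ 0` — contradiction with `Re E(ξ₁) = 0 = Im E(ξ₂)` along `k → ∞`.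

## References

* [folklore] mean value theorem for divided differences; Laurent/Puiseux bookkeeping.
-/

noncomputable section

set_option linter.dupNamespace false

open Filter Topology Polynomial

namespace Summit.Schanuel.Schanuel.Cruxes.MinimalCounterexampleInAcl.KernelArithmeticSelection

/-! ## Part E.  Asymptotics of the root curve `s(τ) = (c + βτ)^{-1/e}` -/

/-- `‖c + βτ‖ → ∞` as `τ → +∞` (`β ≠ 0`). [folklore] -/
theorem coset_norm_tendsto_atTop (c β : ℂ) (hβ : β ≠ 0) :
    Tendsto (fun τ : ℝ => ‖c + β * (τ : ℂ)‖) atTop atTop := by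
  have h1 : Tendsto (fun τ : ℝ => ‖β‖ * τ + -‖c‖) atTop atTop :=
    tendsto_atTop_add_const_right _ _ (Tendsto.const_mul_atTop (norm_pos_iff.2 hβ) tendsto_id)
  refine tendsto_atTop_mono' atTop ?_ h1
  filter_upwards [eventually_ge_atTop (0 : ℝ)] with τ hτ
  have : ‖β * (τ : ℂ)‖ ≤ ‖c + β * τ‖ + ‖c‖ := by
    calc ‖β * (τ : ℂ)‖ = ‖(c + β * τ) - c‖ := by ring_nf
      _ ≤ ‖c + β * τ‖ + ‖c‖ := norm_sub_le _ _
  rw [norm_mul, Complex.norm_real, Real.norm_eq_abs, abs_of_nonneg hτ] at this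
  linarith

/-- `s(τ) → 0` as `τ → +∞`. [folklore] -/
theorem coset_root_tendsto_zero {e : ℕ} (he : 0 < e) (c β : ℂ) (hβ : β ≠ 0) :
    Tendsto (fun τ : ℝ => (c + β * (τ : ℂ)) ^ (-((e : ℂ)⁻¹))) atTop (𝓝 0) := by
  rw [tendsto_zero_iff_norm_tendsto_zero]
  have hexp : (-((e : ℂ)⁻¹)) = ((-(e : ℝ)⁻¹ : ℝ) : ℂ) := by push_cast; ring
  have h := (tendsto_rpow_neg_atTop (by positivity : 0 < (e : ℝ)⁻¹)).comp
    (coset_norm_tendsto_atTop c β hβ)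
  refine h.congr' (Eventually.of_forall fun τ => ?_)
  simp only [Function.comp_def]
  rw [hexp, Complex.norm_cpow_real]

/-- `arg (c + βτ) → arg β` as `τ → +∞` (`Im β ≠ 0`). [folklore] -/
theorem coset_arg_tendsto (c β : ℂ) (hβ : β.im ≠ 0) :
    Tendsto (fun τ : ℝ => Complex.arg (c + β * (τ : ℂ))) atTop (𝓝 (Complex.arg β)) := by
  have hslit : β ∈ Complex.slitPlane := Complex.mem_slitPlane_iff.2 (Or.inr hβ)
  have hinv : Tendsto (fun τ : ℝ => ((τ⁻¹ : ℝ) : ℂ)) atTop (𝓝 0) := by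
    have := (Complex.continuous_ofReal.tendsto 0).comp tendsto_inv_atTop_zero
    simpa [Function.comp_def] using this
  have h2 : Tendsto (fun τ : ℝ => c * ((τ⁻¹ : ℝ) : ℂ) + β) atTop (𝓝 β) := by
    simpa using ((tendsto_const_nhds (x := c)).mul hinv).add (tendsto_const_nhds (x := β))
  have h3 := ((Complex.continuousAt_arg hslit).tendsto).comp h2
  refine h3.congr' ?_
  filter_upwards [eventually_gt_atTop (0 : ℝ)] with τ hτ
  simp only [Function.comp_def]
  have hτ0 : (τ : ℂ) ≠ 0 := Complex.ofReal_ne_zero.2 hτ.ne'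
  have : c + β * (τ : ℂ) = (τ : ℂ) * (c * ((τ⁻¹ : ℝ) : ℂ) + β) := by
    push_cast; field_simp
  rw [this, Complex.arg_real_mul _ hτ]

/-- Eventually `Im (c + βτ) ≠ 0` (`Im β ≠ 0`). [folklore] -/
theorem coset_im_eventually_ne (c β : ℂ) (hβ : β.im ≠ 0) :
    ∀ᶠ τ : ℝ in atTop, (c + β * (τ : ℂ)).im ≠ 0 := by
  have hβ' : 0 < |β.im| := abs_pos.2 hβ
  filter_upwards [eventually_ge_atTop ((|c.im| + 1) / |β.im|)] with τ hτ
  have hτ0 : 0 ≤ τ := le_trans (by positivity) hτ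
  have h1 : |c.im| + 1 ≤ |β.im| * τ := by
    rw [div_le_iff₀ hβ'] at hτ; linarith
  have him : (c + β * (τ : ℂ)).im = c.im + β.im * τ := by simp
  rw [him]
  intro h
  have h2 : |β.im * τ| = |c.im| := by
    rw [show β.im * τ = -c.im by linarith, abs_neg]
  rw [abs_mul, abs_of_nonneg hτ0] at h2
  linarith

/-! ## Part F.  The one-sided tail lemma and the theorem -/

/-- **One tail.**  For `Im β ≠ 0` only finitely many `k ≥ 0` have all translates `k + j`,
`j ∈ G`, hitting: `M ((c + β(k+j))^{-1/e}) ∈ 2πiℤ`. [folklore] -/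
theorem coset_tail (e p : ℕ) (M : ℂ → ℂ) (c β : ℂ) (G : Finset ℤ) (he : 0 < e)
    (hF : AnalyticAt ℂ (fun t : ℂ => t ^ p * M t) 0)
    (hnd : ¬ ∃ Q : Polynomial ℂ, ∀ᶠ t in 𝓝[≠] (0 : ℂ), M t = Q.eval (t ^ e)⁻¹)
    (hG : p + 2 ≤ G.card) (hβ : β.im ≠ 0) :
    Set.Finite {k : ℤ | 0 ≤ k ∧ ∀ j ∈ G, ∃ L : ℤ,
      M ((c + β * ((k + j : ℤ) : ℂ)) ^ (-((e : ℂ)⁻¹))) = (L : ℂ) * (2 * ↑Real.pi * Complex.I)} := by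
  classical
  -- Step 0: notation and the chains
  set F : ℂ → ℂ := fun t => t ^ p * M t with hFdef
  have hFM : ∀ t, F t = t ^ p * M t := fun t => rfl
  obtain ⟨ρ, hρ, hFρ⟩ : ∃ ρ > 0, AnalyticOnNhd ℂ F (Metric.ball 0 ρ) := by
    obtain ⟨ρ, hρ, h⟩ := Metric.eventually_nhds_iff_ball.1 hF.eventually_analyticAt
    exact ⟨ρ, hρ, fun t ht => h t ht⟩
  have hβ0 : β ≠ 0 := fun h => hβ (by simp [h])
  have he0 : (e : ℂ) ≠ 0 := by exact_mod_cast he.ne'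
  set α : ℂ := -β / e with hαdef
  have hα : α ≠ 0 := div_ne_zero (neg_ne_zero.2 hβ0) he0
  obtain ⟨Fk, hFk0, hFks⟩ : ∃ Fk : ℕ → ℂ → ℂ, Fk 0 = F ∧ ∀ k, Fk (k + 1) =
      fun t => α * (t * deriv (Fk k) t + (((k * e : ℕ) : ℂ) - p) * Fk k t) :=
    ⟨fun k => Nat.rec F
      (fun k fk => fun t => α * (t * deriv fk t + (((k * e : ℕ) : ℂ) - p) * fk t)) k,
      rfl, fun k => rfl⟩
  set Mk : ℕ → ℂ → ℂ := fun k t => Fk k t * t ^ (((k * e : ℕ) : ℤ) - p) with hMkdef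
  have hMk : ∀ k t, Mk k t = Fk k t * t ^ (((k * e : ℕ) : ℤ) - p) := fun k t => rfl
  obtain ⟨n, hn, hcard⟩ : ∃ n : ℕ, p + 1 ≤ n ∧ G.card = n + 1 :=
    ⟨G.card - 1, by omega, by omega⟩
  set g : Fin (n + 1) ↪o ℤ := G.orderEmbOfFin hcard with hgdef
  have hgmem : ∀ i, g i ∈ G := fun i => Finset.orderEmbOfFin_mem G hcard i
  have hgmono : StrictMono g := g.strictMono
  -- Step 1: `F_n` is not identically zero near `0`
  have hFn_an : AnalyticAt ℂ (Fk n) 0 :=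
    coset_Fk_analyticOnNhd hFρ hFk0 hFks n 0 (Metric.mem_ball_self hρ)
  have hFn_nz : ¬ ∀ᶠ t in 𝓝 (0 : ℂ), Fk n t = 0 := fun hz =>
    hnd (coset_degenerate he hα hρ hFρ hFM hFk0 hFks hMk hz)
  obtain ⟨m, v, hv_an, hv0, hv_eq⟩ :=
    hFn_an.exists_eventuallyEq_pow_smul_nonzero_iff.2 hFn_nz
  obtain ⟨ρ₂, hρ₂, hρ₂v⟩ := Metric.eventually_nhds_iff_ball.1 hv_eq
  -- Step 2: the root curve and its asymptotics
  set u : ℝ → ℂ := fun τ => c + β * (τ : ℂ) with hudef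
  set s : ℝ → ℂ := fun τ => (c + β * (τ : ℂ)) ^ (-((e : ℂ)⁻¹)) with hsdef
  set y : ℝ := -(e : ℝ)⁻¹ with hydef
  have hexp : (-((e : ℂ)⁻¹)) = ((y : ℝ) : ℂ) := by push_cast [hydef]; ring
  have hs_tend : Tendsto s atTop (𝓝 0) := coset_root_tendsto_zero he c β hβ0
  have harg : Tendsto (fun τ => Complex.arg (u τ)) atTop (𝓝 (Complex.arg β)) :=
    coset_arg_tendsto c β hβ
  have hne : p ≤ n * e := by nlinarith
  set N' : ℕ := m + (n * e - p) with hN'def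
  have hN' : N' ≠ 0 := by
    have : p + 1 ≤ n * e := by nlinarith
    omega
  set ε : ℝ → ℂ := fun τ =>
    Complex.exp (((Complex.arg (u τ) * y : ℝ) : ℂ) * Complex.I) with hεdef
  set E : ℝ → ℂ := fun τ => ε τ ^ N' * v (s τ) with hEdef
  set z₀ : ℂ := Complex.exp (((Complex.arg β * y : ℝ) : ℂ) * Complex.I) ^ N' * v 0 with hz₀def
  have hz₀ : z₀ ≠ 0 := mul_ne_zero (pow_ne_zero _ (Complex.exp_ne_zero _)) hv0
  have hE_tend : Tendsto E atTop (𝓝 z₀) := by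
    have h1 : Tendsto ε atTop
        (𝓝 (Complex.exp (((Complex.arg β * y : ℝ) : ℂ) * Complex.I))) := by
      refine (Complex.continuous_exp.tendsto _).comp ?_
      refine Tendsto.mul_const _ ?_
      exact (Complex.continuous_ofReal.tendsto _).comp (harg.mul_const y)
    have h2 : Tendsto (fun τ => v (s τ)) atTop (𝓝 (v 0)) :=
      hv_an.continuousAt.tendsto.comp hs_tend
    exact (h1.pow N').mul h2
  have hMkn : ∀ τ, s τ ∈ Metric.ball (0 : ℂ) ρ₂ → Mk n (s τ) = (s τ) ^ N' * v (s τ) := by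
    intro τ hsb
    rw [hMk, hρ₂v _ hsb, sub_zero, smul_eq_mul]
    have : (s τ) ^ (((n * e : ℕ) : ℤ) - p) = (s τ) ^ (n * e - p : ℕ) := by
      rw [← Nat.cast_sub hne, zpow_natCast]
    rw [this, hN'def, pow_add]
    ring
  have hpolar : ∀ τ, u τ ≠ 0 → s τ ∈ Metric.ball (0 : ℂ) ρ₂ →
      Mk n (s τ) = (((‖u τ‖ ^ y) ^ N' : ℝ) : ℂ) * E τ := by
    intro τ hu0 hsb
    have h2 : s τ = ((‖u τ‖ ^ y : ℝ) : ℂ) * ε τ := by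
      show (c + β * (τ : ℂ)) ^ (-((e : ℂ)⁻¹)) = _
      rw [hexp]
      exact coset_cpow_polar hu0 y
    have h3 : (s τ) ^ N' = (((‖u τ‖ ^ y) ^ N' : ℝ) : ℂ) * ε τ ^ N' := by
      rw [h2, mul_pow]; push_cast; ring
    rw [hMkn τ hsb, h3]
    simp only [hEdef]
    ring
  have hdecay : Tendsto (fun τ => Mk n (s τ)) atTop (𝓝 0) := by
    have h1 : Tendsto (fun τ => (s τ) ^ N' * v (s τ)) atTop (𝓝 0) := by
      have := (hs_tend.pow N').mul (hv_an.continuousAt.tendsto.comp hs_tend)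
      simpa [zero_pow hN'] using this
    refine h1.congr' ?_
    filter_upwards [hs_tend.eventually_mem (Metric.ball_mem_nhds 0 hρ₂)] with τ h1
    exact (hMkn τ h1).symm
  -- Step 3: the lattice constant and a threshold
  obtain ⟨hW0, hWZ⟩ := coset_lattice (fun i => g i) hgmono.injective
  set W : ℤ := ∏ i, ∏ j ∈ Finset.univ.erase i, (g i - g j) with hWdef
  have hev : ∀ᶠ τ : ℝ in atTop, (u τ).im ≠ 0 ∧ s τ ∈ Metric.ball (0 : ℂ) ρ ∧
      s τ ∈ Metric.ball (0 : ℂ) ρ₂ ∧ ‖Mk n (s τ)‖ * |(W : ℝ)| < 1 := by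
    refine (coset_im_eventually_ne c β hβ).and
      ((hs_tend.eventually_mem (Metric.ball_mem_nhds 0 hρ)).and
        ((hs_tend.eventually_mem (Metric.ball_mem_nhds 0 hρ₂)).and ?_))
    have : Tendsto (fun τ => ‖Mk n (s τ)‖ * |(W : ℝ)|) atTop (𝓝 0) := by
      simpa using (tendsto_zero_iff_norm_tendsto_zero.1 hdecay).mul_const |(W : ℝ)|
    exact this.eventually (eventually_lt_nhds zero_lt_one)
  obtain ⟨T, hT⟩ := eventually_atTop.1 hev
  have hu0T : ∀ τ, T ≤ τ → u τ ≠ 0 := fun τ hτ h => (hT τ hτ).1 (by simp [h])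
  have hchain : ∀ k τ, T ≤ τ → HasDerivAt (fun σ => Mk k (s σ)) (Mk (k + 1) (s τ)) τ := by
    intro k τ hτ
    obtain ⟨him, hb, -, -⟩ := hT τ hτ
    exact coset_chain he hαdef hFρ hFk0 hFks hMk k (Complex.mem_slitPlane_iff.2 (Or.inr him)) hb
  have hpol : ∀ τ, T ≤ τ →
      Mk n (s τ) = (((‖u τ‖ ^ y) ^ N' : ℝ) : ℂ) * E τ ∧ 0 < (‖u τ‖ ^ y) ^ N' := by
    intro τ hτ
    obtain ⟨-, -, hb2, -⟩ := hT τ hτ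
    exact ⟨hpolar τ (hu0T τ hτ) hb2,
      pow_pos (Real.rpow_pos_of_pos (norm_pos_iff.2 (hu0T τ hτ)) y) N'⟩
  -- Step 4: the window consequence
  have hwindow : ∀ k : ℤ, T ≤ (k : ℝ) + g 0 →
      (∀ i, ∃ L : ℤ, M (s ((k : ℝ) + g i)) = (L : ℂ) * (2 * Real.pi * Complex.I)) →
      (∃ ξ₁, (k : ℝ) + g 0 ≤ ξ₁ ∧ (E ξ₁).re = 0) ∧
      (∃ ξ₂, (k : ℝ) + g 0 ≤ ξ₂ ∧ (E ξ₂).im = 0) := by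
    intro k hk hhit
    choose L hL using hhit
    set x : Fin (n + 1) → ℝ := fun i => (k : ℝ) + g i with hxdef
    have hxmono : StrictMono x := fun i j hij => by
      have : ((g i : ℤ) : ℝ) < g j := Int.cast_lt.2 (hgmono hij)
      simp only [hxdef]
      linarith
    have hxI : ∀ i, x i ∈ Set.Icc (x 0) (x (Fin.last n)) := fun i =>
      ⟨hxmono.monotone (Fin.zero_le i), hxmono.monotone (Fin.le_last i)⟩
    have hxT : ∀ τ ∈ Set.Icc (x 0) (x (Fin.last n)), T ≤ τ := fun τ hτ => hk.trans hτ.1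
    have hs0x : ∀ i, s (x i) ≠ 0 := fun i =>
      Complex.cpow_ne_zero_iff.2 (Or.inl (hu0T _ (hxT _ (hxI i))))
    have hval : ∀ i, Mk 0 (s (x i)) = (L i : ℂ) * (2 * Real.pi * Complex.I) := fun i => by
      rw [coset_Mk_zero hFM hFk0 hMk (hs0x i)]; exact hL i
    have hval_re : ∀ i, (Mk 0 (s (x i))).re = 0 := fun i => by rw [hval i]; simp
    have hval_im : ∀ i, (Mk 0 (s (x i))).im = 2 * Real.pi * L i := fun i => by
      rw [hval i]; simp; ring
    have hwt : ∀ i, (∏ j ∈ Finset.univ.erase i, (x i - x j)) =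
        ∏ j ∈ Finset.univ.erase i, ((g i : ℝ) - g j) :=
      fun i => Finset.prod_congr rfl fun j _ => by simp only [hxdef]; ring
    constructor
    · obtain ⟨ξ, hξI, hξ⟩ := coset_dividedDiff_mvt (fun k τ => (Mk k (s τ)).re)
        (fun k _ τ hτ => coset_hasDerivAt_re (hchain k τ (hxT τ hτ))) x hxmono hxI
      have hξ' : (Mk n (s ξ)).re = n.factorial *
          ∑ i, (Mk 0 (s (x i))).re / ∏ j ∈ Finset.univ.erase i, (x i - x j) := hξ
      have hsum : (∑ i, (Mk 0 (s (x i))).re / ∏ j ∈ Finset.univ.erase i, (x i - x j)) = 0 := by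
        simp [hval_re]
      rw [hsum, mul_zero] at hξ'
      obtain ⟨hp1, hp2⟩ := hpol ξ (hxT ξ hξI)
      refine ⟨ξ, hξI.1, ?_⟩
      rw [hp1, Complex.re_ofReal_mul] at hξ'
      exact (mul_eq_zero.1 hξ').resolve_left hp2.ne'
    · obtain ⟨ξ, hξI, hξ⟩ := coset_dividedDiff_mvt (fun k τ => (Mk k (s τ)).im)
        (fun k _ τ hτ => coset_hasDerivAt_im (hchain k τ (hxT τ hτ))) x hxmono hxI
      have hξ' : (Mk n (s ξ)).im = n.factorial *
          ∑ i, (Mk 0 (s (x i))).im / ∏ j ∈ Finset.univ.erase i, (x i - x j) := hξ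
      obtain ⟨Z, hZ⟩ := hWZ L
      have hsum : (∑ i, (Mk 0 (s (x i))).im / ∏ j ∈ Finset.univ.erase i, (x i - x j)) =
          2 * Real.pi * ∑ i, (L i : ℝ) / ∏ j ∈ Finset.univ.erase i, ((g i : ℝ) - g j) := by
        rw [Finset.mul_sum]
        refine Finset.sum_congr rfl fun i _ => ?_
        rw [hval_im, hwt]
        ring
      rw [hsum] at hξ'
      have hkey : (Mk n (s ξ)).im * W = 2 * Real.pi * n.factorial * Z := by
        rw [hξ', ← hZ]
        ring
      obtain ⟨-, -, -, hb4⟩ := hT ξ (hxT ξ hξI)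
      have hZ0 : Z = 0 := by
        have h1 : |(Mk n (s ξ)).im * (W : ℝ)| < 1 := by
          rw [abs_mul]
          exact lt_of_le_of_lt
            (mul_le_mul_of_nonneg_right (Complex.abs_im_le_norm _) (abs_nonneg _)) hb4
        rw [hkey] at h1
        have h2 : (1 : ℝ) ≤ 2 * Real.pi * n.factorial := by
          have : (1 : ℝ) ≤ n.factorial := by exact_mod_cast Nat.factorial_pos n
          nlinarith [Real.pi_gt_three]
        have h3 : |(Z : ℝ)| < 1 := by
          rw [abs_mul, abs_of_pos (by positivity : (0 : ℝ) < 2 * Real.pi * n.factorial)] at h1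
          by_contra hcon
          push Not at hcon
          nlinarith [abs_nonneg (Z : ℝ)]
        have h4 : |Z| < 1 := by exact_mod_cast h3
        exact Int.abs_lt_one_iff.1 h4
      rw [hZ0, Int.cast_zero, mul_zero] at hkey
      have hW0' : ((W : ℤ) : ℝ) ≠ 0 := by exact_mod_cast hW0
      have him0 : (Mk n (s ξ)).im = 0 := (mul_eq_zero.1 hkey).resolve_right hW0'
      obtain ⟨hp1, hp2⟩ := hpol ξ (hxT ξ hξI)
      refine ⟨ξ, hξI.1, ?_⟩
      rw [hp1, Complex.im_ofReal_mul] at him0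
      exact (mul_eq_zero.1 him0).resolve_left hp2.ne'
  -- Step 5: conclusion
  rw [← Set.not_infinite]
  intro hinf
  have hunb : ∀ T' : ℝ, ∃ k : ℤ, (0 ≤ k ∧ ∀ j ∈ G, ∃ L : ℤ,
      M ((c + β * ((k + j : ℤ) : ℂ)) ^ (-((e : ℂ)⁻¹))) = (L : ℂ) * (2 * ↑Real.pi * Complex.I)) ∧
      T' ≤ (k : ℝ) + g 0 := by
    intro T'
    by_contra hcon
    push Not at hcon
    refine hinf ((Set.finite_Icc (0 : ℤ) ⌈T' - g 0⌉).subset ?_)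
    intro k hk
    refine ⟨hk.1, ?_⟩
    have h1 : (k : ℝ) + g 0 < T' := hcon k hk
    have h2 : (k : ℝ) ≤ ((⌈T' - g 0⌉ : ℤ) : ℝ) := by
      have := Int.le_ceil (T' - g 0)
      linarith
    exact_mod_cast h2
  have hnode : ∀ (k : ℤ) (i : Fin (n + 1)),
      s ((k : ℝ) + g i) = (c + β * ((k + g i : ℤ) : ℂ)) ^ (-((e : ℂ)⁻¹)) := by
    intro k i
    simp only [hsdef]
    push_cast
    ring_nf
  have hhits : ∀ k : ℤ, (∀ j ∈ G, ∃ L : ℤ,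
      M ((c + β * ((k + j : ℤ) : ℂ)) ^ (-((e : ℂ)⁻¹))) = (L : ℂ) * (2 * ↑Real.pi * Complex.I)) →
      ∀ i, ∃ L : ℤ, M (s ((k : ℝ) + g i)) = (L : ℂ) * (2 * Real.pi * Complex.I) := by
    intro k hk i
    rw [hnode]
    exact hk (g i) (hgmem i)
  have hre : z₀.re = 0 := by
    by_contra hne0
    have hev' : ∀ᶠ τ in atTop, (E τ).re ≠ 0 :=
      ((Complex.continuous_re.tendsto z₀).comp hE_tend).eventually_ne hne0
    obtain ⟨T', hT'⟩ := eventually_atTop.1 hev'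
    obtain ⟨k, ⟨-, hk⟩, hkT⟩ := hunb (max T T')
    obtain ⟨⟨ξ₁, hξ₁, hE1⟩, -⟩ := hwindow k ((le_max_left _ _).trans hkT) (hhits k hk)
    exact hT' ξ₁ ((le_max_right _ _).trans (hkT.trans hξ₁)) hE1
  have him : z₀.im = 0 := by
    by_contra hne0
    have hev' : ∀ᶠ τ in atTop, (E τ).im ≠ 0 :=
      ((Complex.continuous_im.tendsto z₀).comp hE_tend).eventually_ne hne0
    obtain ⟨T', hT'⟩ := eventually_atTop.1 hev'
    obtain ⟨k, ⟨-, hk⟩, hkT⟩ := hunb (max T T')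
    obtain ⟨-, ⟨ξ₂, hξ₂, hE2⟩⟩ := hwindow k ((le_max_left _ _).trans hkT) (hhits k hk)
    exact hT' ξ₂ ((le_max_right _ _).trans (hkT.trans hξ₂)) hE2
  exact hz₀ (Complex.ext hre him)

/-- **Stub S4ᶜ — COSET WINDOW RIGIDITY.**  Let `e ≥ 1` and let `M` be meromorphic at `0`
(`t ↦ t ^ p * M t` analytic at `0`) and not of the form `Q((t^e)⁻¹)` near `0`.  Then for every
coset `c + 2πiℤ` and every pattern `G ⊆ ℤ` with `|G| ≥ p + 2`, only finitely many `k ∈ ℤ` have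
all translates `k + j` (`j ∈ G`) hitting: `M ((c + 2πi(k+j))^{-1/e}) ∈ 2πiℤ` (principal power).
[folklore] -/
theorem stub_windowRigidity_coset : ∀ (e p : ℕ) (M : ℂ → ℂ) (c : ℂ) (G : Finset ℤ), 0 < e →
    AnalyticAt ℂ (fun t : ℂ => t ^ p * M t) 0 →
    (¬ ∃ Q : Polynomial ℂ, ∀ᶠ t in 𝓝[≠] (0 : ℂ), M t = Q.eval (t ^ e)⁻¹) → p + 2 ≤ G.card →
    Set.Finite {k : ℤ | ∀ j ∈ G, ∃ L : ℤ, M ((c + 2 * ↑Real.pi * Complex.I * ((k + j : ℤ) : ℂ)) ^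
      (-((e : ℂ)⁻¹))) = (L : ℂ) * (2 * ↑Real.pi * Complex.I)} := by
  intro e p M c G he hF hnd hG
  have hβim : (2 * ↑Real.pi * Complex.I : ℂ).im ≠ 0 := by simp [Real.pi_ne_zero]
  have hβim' : (-(2 * ↑Real.pi * Complex.I) : ℂ).im ≠ 0 := by simp [Real.pi_ne_zero]
  have hpos := coset_tail e p M c (2 * ↑Real.pi * Complex.I) G he hF hnd hG hβim
  have hcardneg : (G.image fun j => -j).card = G.card :=
    Finset.card_image_of_injective _ neg_injective
  have hneg := coset_tail e p M c (-(2 * ↑Real.pi * Complex.I)) (G.image fun j => -j) he hF hnd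
    (by rw [hcardneg]; exact hG) hβim'
  refine (hpos.union (hneg.image fun k => -k)).subset ?_
  intro k hk
  simp only [Set.mem_setOf_eq] at hk
  rcases le_or_gt 0 k with h0 | h0
  · exact Or.inl ⟨h0, hk⟩
  · right
    refine ⟨-k, ⟨by omega, fun j hj => ?_⟩, neg_neg k⟩
    obtain ⟨j', hj', rfl⟩ := Finset.mem_image.1 hj
    obtain ⟨L, hL⟩ := hk j' hj'
    refine ⟨L, ?_⟩
    have : c + -(2 * ↑Real.pi * Complex.I) * ((-k + -j' : ℤ) : ℂ) =
        c + 2 * ↑Real.pi * Complex.I * ((k + j' : ℤ) : ℂ) := by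
      push_cast; ring
    rw [this]
    exact hL

end Summit.Schanuel.Schanuel.Cruxes.MinimalCounterexampleInAcl.KernelArithmeticSelection
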